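import Summits.AtomisticToContinuum.HydrodynamicLimit.Theorems.CollisionIsometryCLTMacroClosureStubThermoEos
import Summits.AtomisticToContinuum.HydrodynamicLimit.Theorems.CollisionIsometryCLTCollisionalTransferLocalityCompressibilityBound
import Summits.AtomisticToContinuum.HydrodynamicLimit.Theses.StiffCollisionalRelaxation
import HarnessLib

/-!
# Sub-goal `engine_relFlux` of the lead's `stub_engine_pointwise` (line `IdeatorTwoGen1Sketch`, crux
`MacroClosure`, stmt-AtomisticToContinuum-14870): Dafermos' relative-flux bound with the hot-cell
truncation

For `U` in a compact part `K` of the chamber of `ThermoChamber η₃` and block states `V` in the band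
`c₁ ≤ V.ρ`, `V.ρ σ³ ≤ 1`, `|V.m|² < 2 V.ρ V.E`, the flux Taylor remainder `Rⱼ(V | U) = fluxRem σ j V U`
satisfies, with ONE constant `C = C(σ, η₃, K, c₁) > 0`: (a) on cells that are not hot (`V.E ≤ M V.ρ`,
`M ≥ 1`) `‖Rⱼ(V | U)‖ ≤ C √M h_σ(V | U)`; (b) always `‖Rⱼ(V | U)‖ ≤ C (V.ρ + |V.m| + V.E + V.E √(V.E / V.ρ))`.

Proof. NEAR `U` (`‖V − U‖ ≤ r`, the closed `r`-neighbourhood of `K` inside the open chamber): the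
fluxes are `C^∞` on the chamber (clause 1), so two mean-value inequalities give the Taylor bound
`‖Rⱼ‖ ≤ L ‖V − U‖²` uniformly (`L` bounds `D²Fⱼ` on the compact neighbourhood), paid by the coercivity
of clause 2, `h_σ ≥ m min(‖V−U‖², ‖V−U‖) = m ‖V − U‖²` (`‖V − U‖ ≤ 1`). FAR from `U`
(`‖V − U‖ > r₀ = min r 1`): `h_σ ≥ m r₀ ‖V − U‖`, while every piece of `Rⱼ` grows at most linearly:
`‖Fⱼ(U)‖, ‖DFⱼ(U)‖ ≤ B` on `K` and `‖Fⱼ(V)‖ ≤ C_F (|m| + E + E √(E/ρ))` on the band — here the open item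
`HsFreeEnergyConvex` enters, through the landed `HemisphereAffineSlaving.abs_hsCompressibility_sub_one_le`
(Ruelle convexity bounds `Z(ρσ³)` for `c₁ ≤ ρ ≤ σ⁻³`, so `|p| ≤ C E`); on `E ≤ Mρ`, `E √(E/ρ) ≤ √M E`.
Bound (b) is the growth bound plus `‖V − U‖ ≤ ‖V‖ + B`.
-/

noncomputable section

open MeasureTheory Filter Set Topology InformationTheory
open scoped ENNReal ContDiff

namespace Summit.AtomisticToContinuum.HydrodynamicLimit.Theorems.MacroClosureLine

open Literature.MathematicalPhysics.KineticTheory Literature.Analysis.FluidPDE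
open Literature.Analysis.FunctionSpaces
open Summit.AtomisticToContinuum.HydrodynamicLimit.Theses

namespace Barycentric

namespace EngineRelFlux

/-- **Second-order Taylor bound.** If `f` is `C^∞` on an open set containing the closed ball
`B(U, ‖V − U‖)` and `‖D²f‖ ≤ L` on that ball, then `‖f V − f U − Df(U)(V − U)‖ ≤ L ‖V − U‖²`
(mean-value inequality for `Df` on the ball, then the mean-value inequality with a fixed linear map).
[folklore] -/
theorem norm_taylor_le {f : State → State} {s : Set State} (hs : IsOpen s)
    (hf : ContDiffOn ℝ ∞ f s) {L : ℝ} {U V : State} (hball : Metric.closedBall U ‖V - U‖ ⊆ s)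
    (hL : ∀ W ∈ Metric.closedBall U ‖V - U‖, ‖fderiv ℝ (fderiv ℝ f) W‖ ≤ L) :
    ‖f V - f U - fderiv ℝ f U (V - U)‖ ≤ L * ‖V - U‖ ^ 2 := by
  have hconv : Convex ℝ (Metric.closedBall U ‖V - U‖) := convex_closedBall U _
  have hU : U ∈ Metric.closedBall U ‖V - U‖ := Metric.mem_closedBall_self (norm_nonneg _)
  have hV : V ∈ Metric.closedBall U ‖V - U‖ := mem_closedBall_iff_norm.2 le_rfl
  have hf1 : ContDiffOn ℝ ∞ (fderiv ℝ f) s := hf.fderiv_of_isOpen hs le_rfl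
  have hdiff : ∀ W ∈ Metric.closedBall U ‖V - U‖, DifferentiableAt ℝ f W := fun W hW =>
    (hf.contDiffAt (hs.mem_nhds (hball hW))).differentiableAt (by simp)
  have hdiff1 : ∀ W ∈ Metric.closedBall U ‖V - U‖, DifferentiableAt ℝ (fderiv ℝ f) W :=
    fun W hW => (hf1.contDiffAt (hs.mem_nhds (hball hW))).differentiableAt (by simp)
  have hL0 : 0 ≤ L := (norm_nonneg (fderiv ℝ (fderiv ℝ f) U)).trans (hL U hU)
  have hlip : ∀ W ∈ Metric.closedBall U ‖V - U‖,
      ‖fderiv ℝ f W - fderiv ℝ f U‖ ≤ L * ‖V - U‖ := by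
    intro W hW
    calc ‖fderiv ℝ f W - fderiv ℝ f U‖ ≤ L * ‖W - U‖ :=
          hconv.norm_image_sub_le_of_norm_fderiv_le hdiff1 hL hU hW
      _ ≤ L * ‖V - U‖ := mul_le_mul_of_nonneg_left (mem_closedBall_iff_norm.1 hW) hL0
  calc ‖f V - f U - fderiv ℝ f U (V - U)‖ ≤ L * ‖V - U‖ * ‖V - U‖ :=
        hconv.norm_image_sub_le_of_norm_fderiv_le' hdiff hlip hU hV
    _ = L * ‖V - U‖ ^ 2 := by ring

/-- **Uniform Taylor bound for the fluxes near a compact part of the chamber**: there are `r > 0`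
and `L ≥ 0` with `‖Rⱼ(V | U)‖ ≤ L ‖V − U‖²` for all `U ∈ K`, `‖V − U‖ ≤ r`, `j` (the closed
`r`-neighbourhood of `K` is a compact part of the open chamber, on which `D²Fⱼ` is bounded).
[folklore] -/
theorem taylor_uniform {σ η : ℝ} {K : Set State} (hK : IsCompact K) (hKsub : K ⊆ chamber σ η)
    (hF : ∀ j, ContDiffOn ℝ ∞ (eulerFlux σ j) (chamber σ η)) :
    ∃ r L : ℝ, 0 < r ∧ 0 ≤ L ∧ ∀ U ∈ K, ∀ V : State, ‖V - U‖ ≤ r → ∀ j,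
      ‖fluxRem σ j V U‖ ≤ L * ‖V - U‖ ^ 2 := by
  have hopen := isOpen_chamber σ η
  obtain ⟨r, hr, hsub⟩ := hK.exists_cthickening_subset_open hopen hKsub
  have hK' : IsCompact (Metric.cthickening r K) := hK.cthickening
  have hF1 : ∀ j, ContDiffOn ℝ ∞ (fderiv ℝ (eulerFlux σ j)) (chamber σ η) := fun j =>
    (hF j).fderiv_of_isOpen hopen le_rfl
  have h2 : ∀ j, ∃ L, ∀ W ∈ Metric.cthickening r K,
      ‖fderiv ℝ (fderiv ℝ (eulerFlux σ j)) W‖ ≤ L := fun j =>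
    hK'.exists_bound_of_continuousOn
      (((hF1 j).continuousOn_fderiv_of_isOpen hopen (by simp)).mono hsub)
  choose L hL using h2
  refine ⟨r, ∑ j, |L j|, hr, Finset.sum_nonneg fun j _ => abs_nonneg _,
    fun U hU V hV j => ?_⟩
  have hball : Metric.closedBall U ‖V - U‖ ⊆ Metric.cthickening r K :=
    (Metric.closedBall_subset_closedBall hV).trans (Metric.closedBall_subset_cthickening hU r)
  have hLj : ∀ W ∈ Metric.closedBall U ‖V - U‖,
      ‖fderiv ℝ (fderiv ℝ (eulerFlux σ j)) W‖ ≤ ∑ i, |L i| := fun W hW =>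
    (hL j W (hball hW)).trans ((le_abs_self _).trans
      (Finset.single_le_sum (fun i _ => abs_nonneg (L i)) (Finset.mem_univ j)))
  exact norm_taylor_le hopen (hF j) (hball.trans hsub) hLj

/-- On a compact `K` inside the chamber: `‖U‖, ‖Fⱼ(U)‖, ‖DFⱼ(U)‖ ≤ B` with one `B ≥ 1`.
[folklore] -/
theorem compact_bounds {σ η : ℝ} {K : Set State} (hK : IsCompact K) (hKsub : K ⊆ chamber σ η)
    (hF : ∀ j, ContDiffOn ℝ ∞ (eulerFlux σ j) (chamber σ η)) :
    ∃ B : ℝ, 1 ≤ B ∧ ∀ U ∈ K, ‖U‖ ≤ B ∧ ∀ j, ‖eulerFlux σ j U‖ ≤ B ∧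
      ‖fderiv ℝ (eulerFlux σ j) U‖ ≤ B := by
  have hopen := isOpen_chamber σ η
  obtain ⟨B₀, hB₀⟩ := hK.exists_bound_of_continuousOn continuous_id.continuousOn
  have h1 : ∀ j, ∃ B, ∀ U ∈ K, ‖eulerFlux σ j U‖ ≤ B := fun j =>
    hK.exists_bound_of_continuousOn ((hF j).continuousOn.mono hKsub)
  have h2 : ∀ j, ∃ B, ∀ U ∈ K, ‖fderiv ℝ (eulerFlux σ j) U‖ ≤ B := fun j =>
    hK.exists_bound_of_continuousOn
      (((hF j).continuousOn_fderiv_of_isOpen hopen (by simp)).mono hKsub)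
  choose B₁ hB₁ using h1
  choose B₂ hB₂ using h2
  have hle : ∀ j, |B₁ j| + |B₂ j| ≤ ∑ i, (|B₁ i| + |B₂ i|) := fun j =>
    Finset.single_le_sum (f := fun i => |B₁ i| + |B₂ i|) (fun i _ => by positivity)
      (Finset.mem_univ j)
  have hsum0 : 0 ≤ ∑ j, (|B₁ j| + |B₂ j|) := Finset.sum_nonneg fun j _ => by positivity
  refine ⟨1 + |B₀| + ∑ j, (|B₁ j| + |B₂ j|), by linarith [abs_nonneg B₀], fun U hU =>
    ⟨?_, fun j => ⟨?_, ?_⟩⟩⟩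
  · linarith [show ‖U‖ ≤ |B₀| from (hB₀ U hU).trans (le_abs_self _)]
  · linarith [(hB₁ j U hU).trans (le_abs_self _), abs_nonneg (B₂ j), abs_nonneg B₀, hle j]
  · linarith [(hB₂ j U hU).trans (le_abs_self _), abs_nonneg (B₁ j), abs_nonneg B₀, hle j]

/-- **Growth of the hs-Euler flux on the band** `c₁ ≤ ρ`, `ρσ³ ≤ 1`, `|m|² ≤ 2ρE`:
`‖Fⱼ(V)‖ ≤ C (|m| + E + E √(E/ρ))`. The pressure `p = ρ θ(V) Z(ρσ³)` has `0 ≤ ρ θ(V) ≤ E` and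
`|Z| ≤ 1 + C_Z` by Ruelle convexity (`HsFreeEnergyConvex`, through
`HemisphereAffineSlaving.abs_hsCompressibility_sub_one_le`); `|m_j| |m|/ρ ≤ 2E` and
`|m|/ρ ≤ 2 √(E/ρ)`. [folklore] -/
theorem norm_eulerFlux_le (hH : StiffCollisionalRelaxation.HsFreeEnergyConvex) {σ : ℝ}
    (hσ : 0 < σ) {c₁ : ℝ} (hc₁ : 0 < c₁) :
    ∃ C : ℝ, 0 < C ∧ ∀ V : State, c₁ ≤ V.1 → V.1 * σ ^ 3 ≤ 1 →
      ‖V.2.1‖ ^ 2 ≤ 2 * V.1 * V.2.2 → ∀ j,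
      ‖eulerFlux σ j V‖ ≤ C * (‖V.2.1‖ + V.2.2 + V.2.2 * Real.sqrt (V.2.2 / V.1)) := by
  obtain ⟨CZ, hCZ0, hCZ⟩ :=
    HemisphereAffineSlaving.abs_hsCompressibility_sub_one_le hH σ hσ c₁ hc₁
  refine ⟨2 * (CZ + 2), by positivity, ?_⟩
  rintro ⟨ρ, mm, E⟩ hρ hpack hkin j
  dsimp only at hρ hpack hkin ⊢
  have hρ0 : 0 < ρ := lt_of_lt_of_le hc₁ hρ
  have hE0 : 0 ≤ E := by nlinarith [sq_nonneg ‖mm‖]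
  simp only [eulerFlux, Prod.norm_mk]
  set θ : ℝ := stateTemp (ρ, mm, E) with hθdef
  set p : ℝ := hsPressure σ ρ θ with hpdef
  -- the temperature
  have hθ0 : 0 ≤ θ := by
    have h : ‖mm‖ ^ 2 / (2 * ρ ^ 2) ≤ E / ρ := by
      rw [div_le_div_iff₀ (by positivity) hρ0]; nlinarith
    simp only [hθdef, stateTemp]
    linarith
  have hθle : θ ≤ E / ρ := by
    have h1 : 0 ≤ ‖mm‖ ^ 2 / (2 * ρ ^ 2) := by positivity
    have h2 : 0 ≤ E / ρ := by positivity
    simp only [hθdef, stateTemp]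
    linarith
  have hρθ : ρ * θ ≤ E := by
    calc ρ * θ ≤ ρ * (E / ρ) := mul_le_mul_of_nonneg_left hθle hρ0.le
      _ = E := by field_simp
  -- the pressure
  have hZ : |hsCompressibility (ρ * σ ^ 3)| ≤ CZ + 1 := by
    have h := hCZ ρ hρ hpack
    calc |hsCompressibility (ρ * σ ^ 3)| = |(hsCompressibility (ρ * σ ^ 3) - 1) + 1| := by
          rw [sub_add_cancel]
      _ ≤ |hsCompressibility (ρ * σ ^ 3) - 1| + |(1 : ℝ)| := abs_add_le _ _
      _ ≤ CZ + 1 := by rw [abs_one]; linarith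
  have hp : |p| ≤ (CZ + 1) * E := by
    have h : p = ρ * θ * hsCompressibility (ρ * σ ^ 3) := rfl
    rw [h, abs_mul, abs_of_nonneg (mul_nonneg hρ0.le hθ0)]
    calc ρ * θ * |hsCompressibility (ρ * σ ^ 3)| ≤ E * (CZ + 1) :=
          mul_le_mul hρθ hZ (abs_nonneg _) hE0
      _ = (CZ + 1) * E := mul_comm _ _
  -- the momentum
  have hmj : |mm j| ≤ ‖mm‖ := by
    have h := PiLp.norm_apply_le mm j
    rwa [Real.norm_eq_abs] at h
  have hs0 : 0 ≤ Real.sqrt (E / ρ) := Real.sqrt_nonneg _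
  have hmρ : ‖mm‖ / ρ ≤ 2 * Real.sqrt (E / ρ) := by
    apply le_of_pow_le_pow_left₀ two_ne_zero (by positivity)
    rw [mul_pow, Real.sq_sqrt (by positivity), div_pow, div_le_iff₀ (by positivity)]
    have h : (2 : ℝ) ^ 2 * (E / ρ) * ρ ^ 2 = 4 * ρ * E := by
      field_simp
      ring
    rw [h]
    nlinarith
  -- the three components
  have hsingle : ‖EuclideanSpace.single j (1 : ℝ)‖ = 1 := by simp
  have hc2 : ‖(mm j / ρ) • mm + p • EuclideanSpace.single j (1 : ℝ)‖ ≤ (CZ + 3) * E := by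
    calc ‖(mm j / ρ) • mm + p • EuclideanSpace.single j (1 : ℝ)‖
        ≤ ‖(mm j / ρ) • mm‖ + ‖p • EuclideanSpace.single j (1 : ℝ)‖ := norm_add_le _ _
      _ = |mm j| / ρ * ‖mm‖ + |p| := by
          rw [norm_smul, norm_smul, hsingle, mul_one, Real.norm_eq_abs, Real.norm_eq_abs, abs_div,
            abs_of_pos hρ0]
      _ ≤ ‖mm‖ / ρ * ‖mm‖ + (CZ + 1) * E := by gcongr
      _ = ‖mm‖ ^ 2 / ρ + (CZ + 1) * E := by ring
      _ ≤ 2 * E + (CZ + 1) * E := by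
          gcongr
          rw [div_le_iff₀ hρ0]
          nlinarith
      _ = (CZ + 3) * E := by ring
  have hc3 : |(E + p) * mm j / ρ| ≤ 2 * (CZ + 2) * (E * Real.sqrt (E / ρ)) := by
    rw [abs_div, abs_mul, abs_of_pos hρ0]
    calc |E + p| * |mm j| / ρ = |E + p| * (|mm j| / ρ) := by ring
      _ ≤ ((CZ + 2) * E) * (2 * Real.sqrt (E / ρ)) := by
          apply mul_le_mul
          · calc |E + p| ≤ |E| + |p| := abs_add_le _ _
              _ ≤ E + (CZ + 1) * E := by rw [abs_of_nonneg hE0]; linarith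
              _ = (CZ + 2) * E := by ring
          · exact (div_le_div_of_nonneg_right hmj hρ0.le).trans hmρ
          · positivity
          · positivity
      _ = 2 * (CZ + 2) * (E * Real.sqrt (E / ρ)) := by ring
  have hS1 : 0 ≤ ‖mm‖ := norm_nonneg _
  have hS3 : 0 ≤ E * Real.sqrt (E / ρ) := mul_nonneg hE0 hs0
  refine max_le ?_ (max_le ?_ ?_)
  · rw [Real.norm_eq_abs]
    nlinarith
  · nlinarith [hc2, mul_nonneg hCZ0 hE0, mul_nonneg hCZ0 hS1, mul_nonneg hCZ0 hS3]
  · rw [Real.norm_eq_abs]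
    nlinarith

/-- On the band `|m|² ≤ 2ρE`, `ρ > 0`, the energy is non-negative. [folklore] -/
theorem energy_nonneg {ρ E x : ℝ} (hρ : 0 < ρ) (hx : 0 ≤ x) (h : x ≤ 2 * ρ * E) : 0 ≤ E := by
  rcases le_or_gt 0 E with h0 | h0
  · exact h0
  · have := mul_neg_of_pos_of_neg (mul_pos two_pos hρ) h0
    linarith

end EngineRelFlux

/-- **`engine_relFlux` (registered sub-goal of the lead's `stub_engine_pointwise`): Dafermos'
relative-flux bound with the hot-cell truncation.** For `U` in a compact part `K` of the chamber of
`ThermoChamber η₃` and block states `V` in the band `c₁ ≤ V.ρ`, `V.ρ σ³ ≤ 1`, there is ONE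
`C = C(σ, η₃, K, c₁) > 0` with (a) `‖Rⱼ(V | U)‖ ≤ C √M h_σ(V | U)` on cells with `V.E ≤ M V.ρ`
(`M ≥ 1`, `|V.m|² < 2 V.ρ V.E`) and (b) `‖Rⱼ(V | U)‖ ≤ C (V.ρ + |V.m| + V.E + V.E √(V.E / V.ρ))`
always (`|V.m|² ≤ 2 V.ρ V.E`). Near `U`: second-order Taylor bound against the quadratic coercivity
of clause 2; far from `U`: linear growth of every piece of `Rⱼ` (Ruelle convexity bounds the
compressibility factor on the band) against the linear coercivity. [folklore] -/
theorem engine_relFlux : ∀ (σ : ℝ), 0 < σ → StiffCollisionalRelaxation.HsFreeEnergyConvex → ∀ η₃ : ℝ, ThermoChamber η₃ → ∀ K : Set State, IsCompact K → K ⊆ chamber σ η₃ → ∀ c₁ : ℝ, 0 < c₁ → c₁ * σ ^ 3 ≤ 1 → ∃ C : ℝ, 0 < C ∧ (∀ M : ℝ, 1 ≤ M → ∀ U ∈ K, ∀ V : State, c₁ ≤ V.1 → V.1 * σ ^ 3 ≤ 1 → ‖V.2.1‖ ^ 2 < 2 * V.1 * V.2.2 → V.2.2 ≤ M * V.1 →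 ∀ j, ‖fluxRem σ j V U‖ ≤ C * Real.sqrt M * relEnt σ V U) ∧ (∀ U ∈ K, ∀ V : State, c₁ ≤ V.1 → V.1 * σ ^ 3 ≤ 1 → ‖V.2.1‖ ^ 2 ≤ 2 * V.1 * V.2.2 → ∀ j, ‖fluxRem σ j V U‖ ≤ C * (V.1 + ‖V.2.1‖ + V.2.2 + V.2.2 * Real.sqrt (V.2.2 / V.1))) := by
  intro σ hσ hH η₃ hT K hK hKsub c₁ hc₁ _hc₁σ
  have hFsm : ∀ j, ContDiffOn ℝ ∞ (eulerFlux σ j) (chamber σ η₃) := (hT σ hσ).1.2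
  obtain ⟨m, hm, hcoer⟩ := (hT σ hσ).2.1 K hK hKsub
  obtain ⟨r, L, hr, hL, htaylor⟩ := EngineRelFlux.taylor_uniform hK hKsub hFsm
  obtain ⟨B, hB, hbounds⟩ := EngineRelFlux.compact_bounds hK hKsub hFsm
  obtain ⟨CF, hCF, hgrowth⟩ := EngineRelFlux.norm_eulerFlux_le hH hσ hc₁
  have hB0 : 0 ≤ B := zero_le_one.trans hB
  -- the crude (at most linear) bound of the remainder
  have hcrude : ∀ U ∈ K, ∀ (V : State) (j : Fin 3),
      ‖fluxRem σ j V U‖ ≤ ‖eulerFlux σ j V‖ + B + B * ‖V - U‖ := by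
    intro U hU V j
    obtain ⟨hFj, hDFj⟩ := (hbounds U hU).2 j
    calc ‖fluxRem σ j V U‖
        = ‖(eulerFlux σ j V - eulerFlux σ j U) - fderiv ℝ (eulerFlux σ j) U (V - U)‖ := rfl
      _ ≤ ‖eulerFlux σ j V - eulerFlux σ j U‖ + ‖fderiv ℝ (eulerFlux σ j) U (V - U)‖ :=
          norm_sub_le _ _
      _ ≤ (‖eulerFlux σ j V‖ + ‖eulerFlux σ j U‖) + ‖fderiv ℝ (eulerFlux σ j) U‖ * ‖V - U‖ :=
          add_le_add (norm_sub_le _ _) (ContinuousLinearMap.le_opNorm _ _)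
      _ ≤ ‖eulerFlux σ j V‖ + B + B * ‖V - U‖ :=
          add_le_add (add_le_add le_rfl hFj) (mul_le_mul_of_nonneg_right hDFj (norm_nonneg _))
  -- `‖V‖ ≤ ‖V - U‖ + B`
  have hVle : ∀ U ∈ K, ∀ V : State, ‖V‖ ≤ ‖V - U‖ + B := by
    intro U hU V
    calc ‖V‖ = ‖(V - U) + U‖ := by rw [sub_add_cancel]
      _ ≤ ‖V - U‖ + ‖U‖ := norm_add_le _ _
      _ ≤ ‖V - U‖ + B := by linarith [(hbounds U hU).1]
  -- the components are bounded by the (sup) norm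
  have hcomp : ∀ V : State, V.1 ≤ ‖V‖ ∧ ‖V.2.1‖ ≤ ‖V‖ ∧ V.2.2 ≤ ‖V‖ := fun V =>
    ⟨(le_abs_self V.1).trans (norm_fst_le V), (norm_fst_le V.2).trans (norm_snd_le V),
      (le_abs_self V.2.2).trans ((norm_snd_le V.2).trans (norm_snd_le V))⟩
  -- the radius and the constants
  obtain ⟨r₀, hr₀def⟩ : ∃ r₀ : ℝ, r₀ = min r 1 := ⟨_, rfl⟩
  have hr₀ : 0 < r₀ := by rw [hr₀def]; exact lt_min hr one_pos
  have hr₀r : r₀ ≤ r := by rw [hr₀def]; exact min_le_left _ _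
  have hr₀1 : r₀ ≤ 1 := by rw [hr₀def]; exact min_le_right _ _
  obtain ⟨C₃, hC₃⟩ : ∃ C₃ : ℝ, C₃ = 3 * CF * (1 + B) + 2 * B := ⟨_, rfl⟩
  have hC₃0 : 0 ≤ C₃ := by rw [hC₃]; positivity
  obtain ⟨Ca, hCa⟩ : ∃ Ca : ℝ, Ca = L / m + C₃ / (m * r₀ ^ 2) := ⟨_, rfl⟩
  have hLm : 0 ≤ L / m := div_nonneg hL hm.le
  have hC₃m : 0 ≤ C₃ / (m * r₀ ^ 2) := by positivity
  have hCa0 : 0 ≤ Ca := by rw [hCa]; positivity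
  obtain ⟨Cb, hCb⟩ : ∃ Cb : ℝ, Cb = CF + B + (B + B * B) / c₁ := ⟨_, rfl⟩
  have hCb0 : 0 < Cb := by rw [hCb]; positivity
  refine ⟨Ca + Cb, by positivity, ?_, ?_⟩
  · -- (a) the relative-flux bound on the cells that are not hot
    intro M hM U hU V hρ hpack hkin hEM j
    have hρ0 : 0 < V.1 := lt_of_lt_of_le hc₁ hρ
    have hco := hcoer U hU V hρ0 (lt_of_le_of_lt hpack (by norm_num)) hkin
    have hd0 : 0 ≤ ‖V - U‖ := norm_nonneg _
    have hrel0 : 0 ≤ relEnt σ V U :=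
      le_trans (mul_nonneg hm.le (le_min (sq_nonneg _) hd0)) hco
    have hsqM : 1 ≤ Real.sqrt M := Real.one_le_sqrt.2 hM
    have hfin : ∀ x : ℝ, x ≤ Ca → x * relEnt σ V U ≤ (Ca + Cb) * Real.sqrt M * relEnt σ V U := by
      intro x hxC
      refine mul_le_mul_of_nonneg_right ?_ hrel0
      calc x ≤ Ca + Cb := by linarith
        _ ≤ (Ca + Cb) * Real.sqrt M := le_mul_of_one_le_right (by positivity) hsqM
    rcases le_or_gt ‖V - U‖ r₀ with hnear | hfar
    · -- near `U`: Taylor against the quadratic coercivity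
      have ht := htaylor U hU V (hnear.trans hr₀r) j
      have hd1 : ‖V - U‖ ≤ 1 := hnear.trans hr₀1
      have hmin : min (‖V - U‖ ^ 2) ‖V - U‖ = ‖V - U‖ ^ 2 :=
        min_eq_left (by rw [sq]; exact mul_le_of_le_one_left hd0 hd1)
      rw [hmin] at hco
      have hd2 : ‖V - U‖ ^ 2 ≤ relEnt σ V U / m := by rw [le_div_iff₀ hm]; linarith
      calc ‖fluxRem σ j V U‖ ≤ L * ‖V - U‖ ^ 2 := ht
        _ ≤ L * (relEnt σ V U / m) := mul_le_mul_of_nonneg_left hd2 hL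
        _ = (L / m) * relEnt σ V U := by ring
        _ ≤ (Ca + Cb) * Real.sqrt M * relEnt σ V U := hfin _ (by rw [hCa]; linarith)
    · -- far from `U`: linear growth against the linear coercivity
      obtain ⟨q, hq⟩ : ∃ q : ℝ, q = ‖V - U‖ / r₀ := ⟨_, rfl⟩
      have hq1 : 1 ≤ q := by rw [hq, one_le_div hr₀]; exact hfar.le
      have hq0 : 0 ≤ q := zero_le_one.trans hq1
      have hdq : ‖V - U‖ ≤ q := by
        rw [hq, le_div_iff₀ hr₀]; exact mul_le_of_le_one_right hd0 hr₀1
      have hBq : B ≤ B * q := le_mul_of_one_le_right hB0 hq1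
      have hVq : ‖V‖ ≤ (1 + B) * q := by
        have h1 := hVle U hU V
        have h2 : (1 + B) * q = q + B * q := by ring
        linarith
      obtain ⟨-, hc2, hc3⟩ := hcomp V
      have hm_le : ‖V.2.1‖ ≤ (1 + B) * q := hc2.trans hVq
      have hE_le : V.2.2 ≤ (1 + B) * q := hc3.trans hVq
      have hsq : Real.sqrt (V.2.2 / V.1) ≤ Real.sqrt M :=
        Real.sqrt_le_sqrt (by rw [div_le_iff₀ hρ0]; exact hEM)
      have hF := hgrowth V hρ hpack hkin.le j
      have hX0 : 0 ≤ (1 + B) * q := by positivity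
      have hsum : ‖V.2.1‖ + V.2.2 + V.2.2 * Real.sqrt (V.2.2 / V.1) ≤
          3 * ((1 + B) * q) * Real.sqrt M := by
        have h1 : ‖V.2.1‖ ≤ (1 + B) * q * Real.sqrt M :=
          hm_le.trans (le_mul_of_one_le_right hX0 hsqM)
        have h2 : V.2.2 ≤ (1 + B) * q * Real.sqrt M :=
          hE_le.trans (le_mul_of_one_le_right hX0 hsqM)
        have h3 : V.2.2 * Real.sqrt (V.2.2 / V.1) ≤ (1 + B) * q * Real.sqrt M :=
          mul_le_mul hE_le hsq (Real.sqrt_nonneg _) hX0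
        linarith
      have hR : ‖fluxRem σ j V U‖ ≤ C₃ * Real.sqrt M * q := by
        have h1 : ‖eulerFlux σ j V‖ ≤ CF * (3 * ((1 + B) * q) * Real.sqrt M) :=
          hF.trans (mul_le_mul_of_nonneg_left hsum hCF.le)
        have h2 : B * ‖V - U‖ ≤ B * q := mul_le_mul_of_nonneg_left hdq hB0
        have h3 : B * q + B * q ≤ (B * q + B * q) * Real.sqrt M :=
          le_mul_of_one_le_right (by positivity) hsqM
        have h4 : C₃ * Real.sqrt M * q =
            CF * (3 * ((1 + B) * q) * Real.sqrt M) + (B * q + B * q) * Real.sqrt M := by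
          rw [hC₃]; ring
        linarith [hcrude U hU V j]
      have hmin : r₀ * ‖V - U‖ ≤ min (‖V - U‖ ^ 2) ‖V - U‖ :=
        le_min (by rw [sq]; exact mul_le_mul_of_nonneg_right hfar.le hd0)
          (mul_le_of_le_one_left hd0 hr₀1)
      have hq_le : q ≤ relEnt σ V U / (m * r₀ ^ 2) := by
        rw [hq, div_le_div_iff₀ hr₀ (by positivity)]
        have h2 : m * (r₀ * ‖V - U‖) ≤ relEnt σ V U :=
          (mul_le_mul_of_nonneg_left hmin hm.le).trans hco
        calc ‖V - U‖ * (m * r₀ ^ 2) = m * (r₀ * ‖V - U‖) * r₀ := by ring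
          _ ≤ relEnt σ V U * r₀ := mul_le_mul_of_nonneg_right h2 hr₀.le
      calc ‖fluxRem σ j V U‖ ≤ C₃ * Real.sqrt M * q := hR
        _ ≤ C₃ * Real.sqrt M * (relEnt σ V U / (m * r₀ ^ 2)) :=
            mul_le_mul_of_nonneg_left hq_le (by positivity)
        _ = (C₃ / (m * r₀ ^ 2)) * Real.sqrt M * relEnt σ V U := by ring
        _ ≤ (Ca + Cb) * Real.sqrt M * relEnt σ V U := by
            refine mul_le_mul_of_nonneg_right ?_ hrel0
            refine mul_le_mul_of_nonneg_right ?_ (Real.sqrt_nonneg _)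
            rw [hCa]; linarith
  · -- (b) the growth bound of the remainder on the whole band
    intro U hU V hρ hpack hkin j
    have hρ0 : 0 < V.1 := lt_of_lt_of_le hc₁ hρ
    have hE0 : 0 ≤ V.2.2 := EngineRelFlux.energy_nonneg hρ0 (sq_nonneg _) hkin
    have hs0 : 0 ≤ V.2.2 * Real.sqrt (V.2.2 / V.1) := mul_nonneg hE0 (Real.sqrt_nonneg _)
    obtain ⟨S, hS⟩ : ∃ S : ℝ, S = V.1 + ‖V.2.1‖ + V.2.2 + V.2.2 * Real.sqrt (V.2.2 / V.1) :=
      ⟨_, rfl⟩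
    rw [← hS]
    have hm0 : 0 ≤ ‖V.2.1‖ := norm_nonneg _
    have hS0 : 0 ≤ S := by rw [hS]; linarith
    have hρS : V.1 ≤ S := by rw [hS]; linarith
    have hFS : ‖eulerFlux σ j V‖ ≤ CF * S :=
      (hgrowth V hρ hpack hkin j).trans (mul_le_mul_of_nonneg_left (by rw [hS]; linarith) hCF.le)
    have hVS : ‖V‖ ≤ S := by
      rw [Prod.norm_def, Prod.norm_def]
      refine max_le ?_ (max_le ?_ ?_)
      · rw [Real.norm_eq_abs, abs_of_pos hρ0]; exact hρS
      · rw [hS]; linarith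
      · rw [Real.norm_eq_abs, abs_of_nonneg hE0, hS]; linarith
    have hdS : ‖V - U‖ ≤ S + B := (norm_sub_le _ _).trans (add_le_add hVS (hbounds U hU).1)
    have hSc : 1 ≤ S / c₁ := by rw [one_le_div hc₁]; exact hρ.trans hρS
    calc ‖fluxRem σ j V U‖ ≤ ‖eulerFlux σ j V‖ + B + B * ‖V - U‖ := hcrude U hU V j
      _ ≤ CF * S + B + B * (S + B) :=
          add_le_add (add_le_add hFS le_rfl) (mul_le_mul_of_nonneg_left hdS hB0)
      _ = (CF + B) * S + (B + B * B) := by ring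
      _ ≤ (CF + B) * S + (B + B * B) * (S / c₁) := by
          have h : B + B * B ≤ (B + B * B) * (S / c₁) := le_mul_of_one_le_right (by positivity) hSc
          linarith
      _ = Cb * S := by rw [hCb]; ring
      _ ≤ (Ca + Cb) * S := mul_le_mul_of_nonneg_right (by linarith) hS0

end Barycentric

end Summit.AtomisticToContinuum.HydrodynamicLimit.Theorems.MacroClosureLine

end
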